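import Literature.NumberTheory.EllipticCurves.IsogenyFormulaDegree
import Literature.NumberTheory.EllipticCurves.IsogenyDegreeQuadraticFormProofs
import Literature.NumberTheory.EllipticCurves.FrobeniusTwist
import HarnessLib

/-!
# The complex multiplication `[√d]` from an isogeny onto the quadratic twist, and `[√d]² = [d]`

Topic `NumberTheory/EllipticCurves` (trunk T-ELLARITH, notion `cm_endomorphisms_isogeny`).
For a CM elliptic curve `E : y² = x³ + A x + B` over `ℚ` with `End_{ℚ̄}(E) ≅ 𝓞_K`,
`K = ℚ(√d)`, the endomorphism `[√d]` is `τ ∘ φ`, where `φ : E → E' = E/E[√d]` is the cyclic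
`|d|`-isogeny with kernel `E[√d]` — defined over `ℚ`, onto the quadratic twist
`E' = E^{(d)} : y² = x³ + d²A x + d³B` — and `τ : E' ⥲ E`, `(x, y) ↦ (x/d, y/(d√d))` is the
twisting isomorphism over `K` (Silverman, *Advanced Topics*, II §2, Prop. II.2.3.1 and
Example II.2.3.2 for `d = -1, -2, -7`; the tree's certificates `CMIsogenyCertificates` give `φ`
for `d = -7, -11, -19, -43, -67, -163`). In the explicit standard form of *AEC* Remark III.4.13.3
this composite is again an isogeny formula, with the same `U, S` and with `h` replaced by
`√d · h` (`IsogenyFormula.twist`). This file proves, for the isogeny `ψ = [√d]` attached to the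
twisted formula over a field `F ∋ √d` of characteristic `0` (`IsogenyFormula.toIsogeny`,
*AEC* III.4.8):

* `IsogenyFormula.mapPoint_sqrtEndo` — `ψ` anti-commutes with any automorphism `σ` of `F̄`
  with `σ(√d) = -√d`: `σ(ψ P) = -ψ(σ P)` (the formula has rational coefficients except for the
  odd power `(√d)³` in the `y`-coordinate);
* `IsogenyFormula.sqrtEndo_comp_self` — **`ψ ∘ ψ = [-deg U]`** on `E(F̄)`, i.e. `[√d]² = [d]` when
  `deg U = |d|`: by Cor. III.6.3 (the tree's quadratic-form calculus,
  `comp_self_sub_smul_add_smul_id_eq_zero`) `ψ² - tψ + (deg ψ) = 0` with an integer `t`;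
  conjugating by `σ` flips the sign of `t`, so `t = 0`; and `deg ψ = deg U`
  (`IsogenyFormula.deg_toIsogeny`).

This is the characteristic-`0` input of the reduction argument proving Deuring's theorem
(`ComplexMultiplicationDeuringReductionProofs`): no appeal to `End(E) ≅ 𝓞_K` (the unproved
fact `Cox2013_exists_ringEquiv_cmRing_geomEndRing`) is needed.

## References

* [SilvermanAdvancedTopics1994] J. H. Silverman, *Advanced Topics in the Arithmetic of Elliptic
  Curves*, GTM 151 (1994): II §2, Prop. II.2.3.1, Example II.2.3.2; Thm. II.2.2(b).
* [SilvermanAEC2009] J. H. Silverman, *The Arithmetic of Elliptic Curves*, 2nd ed. (2009):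
  Thm. III.4.8, Remark III.4.13.3, Cor. III.6.3, X.§5 (quadratic twists, Prop. X.5.4).

## Design

`noncomputable section`, `open scoped Classical`; deliberate dot-notation extensions in
`namespace WeierstrassCurve.IsogenyFormula`. The twisting data are bundled in the `Prop`-valued
structure `IsogenyFormula.IsTwistBy` (short Weierstrass models, `E' = E^{(d)}`, `T = 0`). The
automorphism `σ` and the square root `r` of `d` are parameters (supplied by the consumer for
`F = ℚ(√d)`), as are the coprimality of `U, h` (from the certificates) and the invariance of
`U, h, S` under `σ` (they have integer coefficients).
-/

noncomputable section

open scoped Classical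

open Polynomial

universe u

namespace WeierstrassCurve

namespace IsogenyFormula

/-! ## Twisting an isogeny onto the quadratic twist into an endomorphism -/

section Twist

variable {R : Type u} [CommRing R] {W W' : WeierstrassCurve R}

/-- **Twisting data**: `W = [0, 0, 0, A, B]` is a short Weierstrass model, `W' = [0, 0, 0, d²A, d³B]`
is its quadratic twist by `d`, and the formula `φ : W → W'` has `T = 0` (its `y`-coordinate is
`S(x) y / h(x)³`). Silverman, *AEC*, X.§5 (twists `E^{(d)}`). [folklore] -/
structure IsTwistBy (φ : IsogenyFormula W W') (d : R) : Prop where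
  /-- `a₁(W) = 0`. -/
  a₁ : W.a₁ = 0
  /-- `a₂(W) = 0`. -/
  a₂ : W.a₂ = 0
  /-- `a₃(W) = 0`. -/
  a₃ : W.a₃ = 0
  /-- `a₁(W') = 0`. -/
  a₁' : W'.a₁ = 0
  /-- `a₂(W') = 0`. -/
  a₂' : W'.a₂ = 0
  /-- `a₃(W') = 0`. -/
  a₃' : W'.a₃ = 0
  /-- `a₄(W') = d² a₄(W)`. -/
  a₄' : W'.a₄ = d ^ 2 * W.a₄
  /-- `a₆(W') = d³ a₆(W)`. -/
  a₆' : W'.a₆ = d ^ 3 * W.a₆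
  /-- `T = 0`. -/
  T : φ.T = 0

variable (φ : IsogenyFormula W W') {d : R} (H : φ.IsTwistBy d) (u : R) (hu : u ^ 2 = d)
  (hu0 : ∀ q : R[X], C u * q = 0 → q = 0)

/-- **The twisted formula `τ ∘ φ : W → W`**, `τ(x, y) = (x/d, y/(d u))` with `u² = d`: in standard
form `(U/h'², S y/h'³)` with `h' = u · h` (indeed `U/(u h)² = (U/h²)/d` and
`S y/(u h)³ = (S y/h³)/(d u)`). The identities of `φ` transform into those of the twisted formula
because `(u h)⁴ = d² h⁴` and `(u h)⁶ = d³ h⁶`. Silverman, *Advanced Topics*, II §2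
(`[√d] = τ ∘ φ`); *AEC*, Remark III.4.13.3. [folklore] -/
def twist : IsogenyFormula W W where
  U := φ.U
  h := C u * φ.h
  S := φ.S
  T := 0
  identity₁ := by
    simp only [H.a₁, H.a₃, map_zero, zero_mul, mul_zero, add_zero]
  identity₀ := by
    have h0 := φ.identity₀
    have hu4 : (C u : R[X]) ^ 4 = C (d ^ 2) := by rw [← C_pow, ← hu]; ring_nf
    have hu6 : (C u : R[X]) ^ 6 = C (d ^ 3) := by rw [← C_pow, ← hu]; ring_nf
    simp only [H.T, H.a₁', H.a₂', H.a₃', H.a₄', H.a₆', H.a₁, H.a₂, H.a₃, map_zero, zero_mul,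
      mul_zero, add_zero, zero_pow two_ne_zero, zero_sub, map_mul, map_pow] at h0 ⊢
    rw [mul_pow, mul_pow, hu4, hu6, map_pow, map_pow]
    linear_combination h0
  h_ne_zero := fun h0 ↦ φ.h_ne_zero (hu0 _ h0)
  natDegree_lt := by
    calc ((C u * φ.h) ^ 2).natDegree = (C (u ^ 2) * φ.h ^ 2).natDegree := by
          rw [mul_pow, C_pow]
      _ ≤ (φ.h ^ 2).natDegree := natDegree_C_mul_le _ _
      _ < φ.U.natDegree := φ.natDegree_lt

/-- The data of the twisted formula. [folklore] -/
@[simp] theorem twist_U : (φ.twist H u hu hu0).U = φ.U := rfl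
/-- The data of the twisted formula. [folklore] -/
@[simp] theorem twist_h : (φ.twist H u hu hu0).h = C u * φ.h := rfl
/-- The data of the twisted formula. [folklore] -/
@[simp] theorem twist_S : (φ.twist H u hu hu0).S = φ.S := rfl
/-- The data of the twisted formula. [folklore] -/
@[simp] theorem twist_T : (φ.twist H u hu hu0).T = 0 := rfl

end Twist

/-! ## The endomorphism `[√d]` over a field of characteristic `0` -/

section Field

/-- In a field, `C r` is cancellable for `r ≠ 0`. [folklore] -/
theorem C_mul_cancel {F : Type u} [Field F] {r : F} (hr0 : r ≠ 0) (q : F[X]) (h : C r * q = 0) :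
    q = 0 := by
  rcases mul_eq_zero.mp h with h | h
  · exact absurd (C_eq_zero.mp h) hr0
  · exact h

variable {F : Type u} [Field F] [CharZero F] {W W' : WeierstrassCurve F} [W.IsElliptic]
  (φ : IsogenyFormula W W') {d : F} (H : φ.IsTwistBy d) (r : F) (hr : r ^ 2 = d) (hr0 : r ≠ 0)

/-- **The endomorphism `[√d]`**: the isogeny attached to the twisted formula (Silverman, *AEC*,
Thm. III.4.8; *Advanced Topics*, II §2). [folklore] -/
def sqrtEndo : Isogeny W W :=
  (φ.twist H r hr (C_mul_cancel hr0)).toIsogeny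

/-- Notation-free access to the twisted formula over `F̄`. [folklore] -/
abbrev twistGeom : IsogenyFormula (W.baseChange (AlgebraicClosure F)) (W.baseChange (AlgebraicClosure F)) :=
  (φ.twist H r hr (C_mul_cancel hr0)).geom

/-- The value of `[√d]` at a good affine geometric point is the twisted formula. [folklore] -/
theorem sqrtEndo_some {x y : AlgebraicClosure F}
    (hxy : (W.baseChange (AlgebraicClosure F)).toAffine.Nonsingular x y)
    (hx : (φ.twistGeom H r hr hr0).h.eval x ≠ 0) :
    φ.sqrtEndo H r hr hr0 (.some _ _ hxy) =
      .some _ _ ((φ.twistGeom H r hr hr0).nonsingular_val hxy.1 hx) :=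
  (φ.twist H r hr (C_mul_cancel hr0)).toIsogeny_some hxy hx

omit [CharZero F] [W.IsElliptic] in
/-- `h'(x) = r̄ · h(x)` for the twisted formula read over `F̄`. [folklore] -/
theorem twistGeom_h_eval (x : AlgebraicClosure F) :
    (φ.twistGeom H r hr hr0).h.eval x =
      algebraMap F _ r * (φ.h.map (algebraMap F (AlgebraicClosure F))).eval x := by
  change ((C r * φ.h).map (algebraMap F (AlgebraicClosure F))).eval x = _
  rw [Polynomial.map_mul, map_C, eval_mul, eval_C]

omit [CharZero F] [W.IsElliptic] in
/-- The exceptional set of the twisted formula is that of `h`. [folklore] -/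
theorem twistGeom_h_eval_eq_zero_iff (x : AlgebraicClosure F) :
    (φ.twistGeom H r hr hr0).h.eval x = 0 ↔ (φ.h.map (algebraMap F (AlgebraicClosure F))).eval x = 0 := by
  rw [twistGeom_h_eval, mul_eq_zero, or_iff_right]
  exact (map_ne_zero_iff _ (algebraMap F (AlgebraicClosure F)).injective).mpr hr0

/-! ### Anti-commutation with a conjugation `σ(√d) = -√d` -/

variable (σ : AlgebraicClosure F ≃+* AlgebraicClosure F)
  (hσ : σ (algebraMap F _ r) = -algebraMap F _ r)
  (hσW : (W.baseChange (AlgebraicClosure F)).map σ.toRingHom = W.baseChange (AlgebraicClosure F))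
  (hσU : (φ.U.map (algebraMap F (AlgebraicClosure F))).map σ.toRingHom =
    φ.U.map (algebraMap F (AlgebraicClosure F)))
  (hσh : (φ.h.map (algebraMap F (AlgebraicClosure F))).map σ.toRingHom =
    φ.h.map (algebraMap F (AlgebraicClosure F)))
  (hσS : (φ.S.map (algebraMap F (AlgebraicClosure F))).map σ.toRingHom =
    φ.S.map (algebraMap F (AlgebraicClosure F)))

omit [CharZero F] in
/-- Evaluating a `σ`-invariant polynomial commutes with `σ`. [folklore] -/
theorem apply_eval_of_map_eq {q : (AlgebraicClosure F)[X]} (hq : q.map σ.toRingHom = q)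
    (x : AlgebraicClosure F) : σ (q.eval x) = q.eval (σ x) := by
  have h : (q.map σ.toRingHom).eval (σ.toRingHom x) = σ.toRingHom (q.eval x) := by
    rw [eval_map, eval₂_at_apply]
  rw [hq] at h
  exact h.symm

omit [CharZero F] [W.IsElliptic] in
include hσW in
/-- `σ` carries nonsingular points of `W ⊗ F̄` to nonsingular points. [folklore] -/
theorem nonsingular_apply {a b : AlgebraicClosure F}
    (h : (W.baseChange (AlgebraicClosure F)).toAffine.Nonsingular a b) :
    (W.baseChange (AlgebraicClosure F)).toAffine.Nonsingular (σ a) (σ b) := by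
  have h2 : ((W.baseChange (AlgebraicClosure F)).map σ.toRingHom).toAffine.Nonsingular
      (σ.toRingHom a) (σ.toRingHom b) :=
    (Affine.map_nonsingular (W := W.baseChange (AlgebraicClosure F)) σ.toRingHom.injective a b).mpr h
  rwa [hσW] at h2

include hσ hσU hσh hσS H in
/-- **`σ ∘ [√d] = -[√d] ∘ σ`** for an automorphism `σ` of `F̄` with `σ(√d) = -√d` fixing the
coefficients of `W`, `U`, `h`, `S`: at a good point `(x, y)`,
`σ(U(x)/(r h(x))²) = U(σx)/(r h(σx))²` while `σ(S(x) y/(r h(x))³) = -S(σx) σy/(r h(σx))³`; both sides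
are homomorphisms, so they agree everywhere (`AddMonoidHom.eq_of_eqOn_compl_finite`).
Silverman, *Advanced Topics*, II §2 (Example II.2.3.2: `[√d]` is defined over `ℚ(√d)`, not over
`ℚ`). [folklore] -/
theorem mapPoint_sqrtEndo (P : W.geomPoints) :
    mapPoint σ.toRingHom hσW (φ.sqrtEndo H r hr hr0 P) =
      -(φ.sqrtEndo H r hr hr0 (mapPoint σ.toRingHom hσW P)) := by
  set ψ := φ.sqrtEndo H r hr hr0 with hψ
  let S : W.geomPoints →+ W.geomPoints := mapPoint σ.toRingHom hσW
  -- both sides are homomorphisms; compare off the exceptional set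
  suffices h : S.comp ψ.toAddMonoidHom = -(ψ.toAddMonoidHom.comp S) from
    congrArg (fun g : W.geomPoints →+ W.geomPoints ↦ g P) h
  refine Literature.NumberTheory.EllipticCurves.AddMonoidHom.eq_of_eqOn_compl_finite
    (G := W.geomPoints) (S := ((φ.twistGeom H r hr hr0).bad : Set W.geomPoints))
    (φ.twistGeom H r hr hr0).finite_bad fun Q hQ ↦ ?_
  obtain ⟨x, y, hxy, rfl, hx⟩ := (φ.twistGeom H r hr hr0).exists_of_not_mem_bad hQ
  have hx' : (φ.h.map (algebraMap F (AlgebraicClosure F))).eval x ≠ 0 := fun h0 ↦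
    hx ((φ.twistGeom_h_eval_eq_zero_iff H r hr hr0 x).mpr h0)
  have hσx : (φ.h.map (algebraMap F (AlgebraicClosure F))).eval (σ x) ≠ 0 := by
    rw [← apply_eval_of_map_eq σ hσh]; exact (map_ne_zero σ).mpr hx'
  have hσx' : (φ.twistGeom H r hr hr0).h.eval (σ x) ≠ 0 := fun h0 ↦
    hσx ((φ.twistGeom_h_eval_eq_zero_iff H r hr hr0 (σ x)).mp h0)
  -- the four points involved, explicitly
  have hσxy := nonsingular_apply σ hσW hxy
  have hv := (φ.twistGeom H r hr hr0).nonsingular_val hxy.1 hx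
  have hvσ := nonsingular_apply σ hσW hv
  have eSQ : S (.some x y hxy) = .some (σ x) (σ y) hσxy := rfl
  have e1 : ψ (.some x y hxy) = .some _ _ hv := φ.sqrtEndo_some H r hr hr0 hxy hx
  have eSv : S (.some _ _ hv) = .some _ _ hvσ := rfl
  have e2 := φ.sqrtEndo_some H r hr hr0 hσxy hσx'
  change S (ψ (.some x y hxy)) = -(ψ (S (.some x y hxy)))
  rw [e1, eSv, eSQ, e2]
  refine Eq.trans ?_ (Affine.Point.neg_some _).symm
  -- compare coordinates
  have ha₁ : (W.baseChange (AlgebraicClosure F)).toAffine.a₁ = 0 := by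
    change algebraMap F _ W.a₁ = 0; rw [H.a₁, map_zero]
  have ha₃ : (W.baseChange (AlgebraicClosure F)).toAffine.a₃ = 0 := by
    change algebraMap F _ W.a₃ = 0; rw [H.a₃, map_zero]
  have eU : ∀ z, (φ.twistGeom H r hr hr0).U.eval z =
      (φ.U.map (algebraMap F (AlgebraicClosure F))).eval z := fun z ↦ rfl
  have eS : ∀ z, (φ.twistGeom H r hr hr0).S.eval z =
      (φ.S.map (algebraMap F (AlgebraicClosure F))).eval z := fun z ↦ rfl
  have eT : ∀ z, (φ.twistGeom H r hr hr0).T.eval z = 0 := fun z ↦ by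
    change ((0 : F[X]).map _).eval z = 0; rw [Polynomial.map_zero, eval_zero]
  have hrz : algebraMap F (AlgebraicClosure F) r ≠ 0 :=
    (map_ne_zero_iff _ (algebraMap F _).injective).mpr hr0
  congr 1
  · simp only [valX, twistGeom_h_eval, eU, map_div₀, map_pow, map_mul, hσ,
      apply_eval_of_map_eq σ hσU, apply_eval_of_map_eq σ hσh]
    ring
  · rw [Affine.negY, ha₁, ha₃]
    simp only [valY, twistGeom_h_eval, eS, eT, map_div₀, map_pow, map_mul, hσ,
      apply_eval_of_map_eq σ hσS, apply_eval_of_map_eq σ hσh, add_zero, zero_mul, sub_zero]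
    field_simp

/-! ### `[√d] ∘ [√d] = [-deg U]` -/

variable (hcop : IsCoprime (φ.U.map (algebraMap F (AlgebraicClosure F)))
  (φ.h.map (algebraMap F (AlgebraicClosure F))))

include hcop in
/-- `deg [√d] = deg U` (`IsogenyFormula.deg_toIsogeny`; `U` and `r h` are coprime).
[cite: SilvermanAEC2009, Remark III.4.13.3] -/
theorem deg_sqrtEndo : (φ.sqrtEndo H r hr hr0).deg = φ.U.natDegree := by
  refine (φ.twist H r hr (C_mul_cancel hr0)).deg_toIsogeny ?_
  change IsCoprime (φ.U.map _) ((C r * φ.h).map _)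
  rw [Polynomial.map_mul, map_C]
  refine IsCoprime.mul_right ⟨0, C (algebraMap F _ r)⁻¹, ?_⟩ hcop
  have hrz : algebraMap F (AlgebraicClosure F) r ≠ 0 :=
    (map_ne_zero_iff _ (algebraMap F _).injective).mpr hr0
  rw [zero_mul, zero_add, ← C_mul, inv_mul_cancel₀ hrz, C_1]

include hσ hσW hσU hσh hσS hcop H in
/-- **`[√d] ∘ [√d] = [-deg U]` on `E(F̄)`** (so `= [d]` when `deg U = -d`). With
`f = [√d] ∈ End_F(E)`, Cor. III.6.3 gives `f ∘ f - t f + (deg f) = 0` for the integer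
`t = deg(f + 1) - deg f - 1` (`comp_self_sub_smul_add_smul_id_eq_zero`); conjugating by the
bijection `σ` of `E(F̄)`, which anti-commutes with `f` (`mapPoint_sqrtEndo`), gives
`f ∘ f + t f + (deg f) = 0`, hence `2t f = 0`, `t = 0` (degrees), and `f ∘ f = -(deg f)` with
`deg f = deg U` (`deg_sqrtEndo`). Silverman, *Advanced Topics*, II §2 (`[√d]² = [d]`, there from
`[·] : 𝓞_K ≅ End(E)`, Prop. II.1.1); here from Cor. III.6.3 of *AEC*.
[cite: SilvermanAEC2009, Cor. III.6.3] [cite: SilvermanAdvancedTopics1994, II §2, Prop. II.2.3.1] -/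
theorem sqrtEndo_comp_self (P : W.geomPoints) :
    φ.sqrtEndo H r hr hr0 (φ.sqrtEndo H r hr hr0 P) = -((φ.U.natDegree : ℤ) • P) := by
  set ψ := φ.sqrtEndo H r hr hr0 with hψ
  set f : W.geomPoints →+ W.geomPoints := ψ.toAddMonoidHom with hf_def
  set S : W.geomPoints →+ W.geomPoints := mapPoint σ.toRingHom hσW with hS
  have h63 := degHom_isQuadraticForm_holds W W
  have hid : ∀ (m : ℤ) (g : W.geomPoints →+ W.geomPoints) (Q : W.geomPoints),
      (m • g) Q = m • g Q := fun _ _ _ ↦ rfl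
  have hf : f ∈ homModule W W := ψ.toAddMonoidHom_mem_homModule
  have hN : degHom W W f = (φ.U.natDegree : ℤ) := by
    rw [hf_def, degHom_toAddMonoidHom, hψ, φ.deg_sqrtEndo H r hr hr0 hcop]
  -- Cayley–Hamilton: `f² - t f + N = 0`
  set t : ℤ := degHom W W (f + AddMonoidHom.id W.geomPoints) - degHom W W f - 1 with ht
  have hCH : f.comp f - t • f + degHom W W f • AddMonoidHom.id W.geomPoints = 0 :=
    comp_self_sub_smul_add_smul_id_eq_zero h63 hf
  -- conjugation: `S f = -f S`, `S` surjective
  have hanti : S.comp f = -(f.comp S) := by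
    ext Q
    exact φ.mapPoint_sqrtEndo H r hr hr0 σ hσ hσW hσU hσh hσS Q
  have hSsurj : Function.Surjective S := mapPoint_surjective σ.toRingHom hσW σ.surjective
  have hCH' : f.comp f + t • f + degHom W W f • AddMonoidHom.id W.geomPoints = 0 := by
    have h1 : S.comp (f.comp f - t • f + degHom W W f • AddMonoidHom.id W.geomPoints) =
        (f.comp f + t • f + degHom W W f • AddMonoidHom.id W.geomPoints).comp S := by
      ext Q
      have e1 : S (f (f Q)) = f (f (S Q)) := by
        have := congrArg (fun g : W.geomPoints →+ W.geomPoints ↦ g (f Q)) hanti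
        simp only [AddMonoidHom.comp_apply, AddMonoidHom.neg_apply] at this
        rw [this]
        have := congrArg (fun g : W.geomPoints →+ W.geomPoints ↦ g Q) hanti
        simp only [AddMonoidHom.comp_apply, AddMonoidHom.neg_apply] at this
        rw [this, map_neg, neg_neg]
      have e2 : S (f Q) = -f (S Q) := by
        have := congrArg (fun g : W.geomPoints →+ W.geomPoints ↦ g Q) hanti
        simpa only [AddMonoidHom.comp_apply, AddMonoidHom.neg_apply] using this
      simp only [AddMonoidHom.comp_apply, AddMonoidHom.add_apply, AddMonoidHom.sub_apply,
        hid, AddMonoidHom.id_apply, map_add, map_sub, map_zsmul, e1, e2, smul_neg, sub_neg_eq_add]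
    rw [hCH, AddMonoidHom.comp_zero] at h1
    exact ((AddMonoidHom.cancel_right hSsurj).mp (h1.symm.trans (AddMonoidHom.zero_comp S).symm))
  -- hence `2t f = 0`, so `t = 0`
  have h2t : (2 * t) • f = 0 := by
    have := congrArg₂ (· - ·) hCH' hCH
    simp only [sub_zero] at this
    rw [← this]; module
  have ht0 : t = 0 := by
    have h1 := degHom_zsmul h63 hf (2 * t)
    rw [h2t, degHom_zero, hN] at h1
    have hpos : (0 : ℤ) < φ.U.natDegree := by
      have := φ.natDegree_lt
      exact_mod_cast Nat.lt_of_le_of_lt (Nat.zero_le _) this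
    have : (2 * t) ^ 2 = 0 := by
      rcases mul_eq_zero.mp h1.symm with h | h
      · exact h
      · exact absurd h hpos.ne'
    simpa using this
  -- conclude
  rw [ht0, zero_smul, sub_zero, hN] at hCH
  have := congrArg (fun g : W.geomPoints →+ W.geomPoints ↦ g P) hCH
  simp only [AddMonoidHom.add_apply, AddMonoidHom.comp_apply, hid,
    AddMonoidHom.zero_apply] at this
  rw [← eq_neg_iff_add_eq_zero] at this
  exact this

end Field

end IsogenyFormula

end WeierstrassCurve
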